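import Literature.Analysis.FluidPDE.PineauVicolOneSliceGradient
import Literature.Analysis.FluidPDE.PressurePoissonRegion
import HarnessLib

/-!
# Pineau–Vicol 2026, Theorem 1.9 — the printed proof: Lemma 9.2 for all orders near the vertex

Analysis/FluidPDE proof file, companion of `PineauVicolOneSliceGradient.lean` (sibling of the
named fact `Literature.Analysis.FluidPDE.pineauVicol2026_oneSlice_regularity`, B. Pineau,
V. Vicol, arXiv:2607.09619 (2026), Thm. 1.9). Lemma 9.2 (p. 30) bounds all derivatives,
`|∇ᵏu(x, t)| ≤ C_{k,ε} ((−t)^{(k+1)/2} + |x|^{k+1})⁻¹`; Lemma 9.4 uses `k ≤ 2` ((9.5):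
`|∇Ω| ≤ 6K(1 + |y|³)⁻¹`) and a compactness rendering of §9.3 uses `k ≤ 3`. This file extends
the `k = 1` results of `PineauVicolOneSliceGradient.lean` to every order `n`, with the same
proof: `exists_forall_iteratedFDeriv_le_of_bounded` (the quantitative Serrin bound
`‖Dⁿₓu‖ ≤ K/cⁿ⁺¹` on `Q(z, c/2)`; the physical slices are smooth, so the dilation acts on `Dⁿ`
through a globally smooth local representative, `norm_iteratedFDeriv_smul_comp_smul_sub_le`),
`exists_forall_iteratedFDeriv_le_of_typeI` and `exists_forall_iteratedFDeriv_le_of_typeI_of_bounds`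
(`‖Dⁿₓu(x,t)‖ ≤ K(n, C_u) (|x| + √(−t))⁻ⁿ⁻¹` for `|x| + √(−t) ≤ c₁(n, C_u, B_u, B_p)`; the value at
the point itself is read off from the half-cylinder below `(x, (511/512)t)`, which contains it,
so no continuity of `Dⁿu` in time is needed).

## References

* B. Pineau, V. Vicol, arXiv:2607.09619 (2026), Lemmas 9.1–9.2, Cor. 9.3 (p. 30–31).
  [PineauVicol2026]
-/

noncomputable section

open MeasureTheory Set Function Filter Metric TopologicalSpace
open _root_.Topology
open scoped ENNReal NNReal InnerProductSpace RealInnerProductSpace Laplacian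

namespace Literature.Analysis.FluidPDE

section SerrinHigher

-- nested operator types
set_option maxSynthPendingDepth 3

/-- Norm of the iterated derivative of `x ↦ a • H (b • (x − x₀))` for a globally smooth `H`:
`‖Dⁿ(a • H(b(· − x₀)))(x)‖ ≤ |a| |b|ⁿ ‖DⁿH(b(x − x₀))‖` (chain rule with a dilation). [folklore] -/
theorem norm_iteratedFDeriv_smul_comp_smul_sub_le {F : Type*} [NormedAddCommGroup F]
    [NormedSpace ℝ F] {H : EuclideanSpace ℝ (Fin 3) → F} (hH : ContDiff ℝ (⊤ : ℕ∞) H)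
    (a b : ℝ) (x₀ x : EuclideanSpace ℝ (Fin 3)) (n : ℕ) :
    ‖iteratedFDeriv ℝ n (fun y => a • H (b • (y - x₀))) x‖ ≤
      |a| * |b| ^ n * ‖iteratedFDeriv ℝ n H (b • (x - x₀))‖ := by
  set L : EuclideanSpace ℝ (Fin 3) →L[ℝ] EuclideanSpace ℝ (Fin 3) :=
    b • ContinuousLinearMap.id ℝ (EuclideanSpace ℝ (Fin 3)) with hL
  have hHn : ContDiff ℝ n H := hH.of_le (by exact_mod_cast le_top)
  have hHL : ContDiff ℝ n (H ∘ L) := hHn.comp L.contDiff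
  -- remove the scalar factor
  have e1 : (fun y => a • H (b • (y - x₀))) = a • fun y => (H ∘ L) (y - x₀) := by
    funext y; simp [hL]
  have hG : ContDiff ℝ n (fun y : EuclideanSpace ℝ (Fin 3) => (H ∘ L) (y - x₀)) :=
    hHL.comp (contDiff_id.sub contDiff_const)
  rw [e1, iteratedFDeriv_const_smul_apply (a := a) hG.contDiffAt, norm_smul, Real.norm_eq_abs]
  -- translate and dilate
  rw [iteratedFDeriv_comp_sub, L.iteratedFDeriv_comp_right hHn (x - x₀) le_rfl]
  have hLx : L (x - x₀) = b • (x - x₀) := by simp [hL]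
  rw [hLx, mul_assoc]
  refine mul_le_mul_of_nonneg_left ?_ (abs_nonneg a)
  refine (ContinuousMultilinearMap.norm_compContinuousLinearMap_le _ _).trans ?_
  rw [Finset.prod_const, Finset.card_univ, Fintype.card_fin, mul_comm]
  have hLn : ‖L‖ ≤ |b| := by
    rw [hL, norm_smul, Real.norm_eq_abs]
    calc |b| * ‖ContinuousLinearMap.id ℝ (EuclideanSpace ℝ (Fin 3))‖ ≤ |b| * 1 := by
          gcongr; exact ContinuousLinearMap.norm_id_le
      _ = |b| := mul_one _
  exact mul_le_mul_of_nonneg_right (pow_le_pow_left₀ (norm_nonneg _) hLn n) (norm_nonneg _)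

/-- **Serrin-type bounds for all derivatives of bounded classical solutions with an `L^{3/2}`
pressure, quantitative** (the `n`-th order version of `exists_forall_fderiv_le_of_bounded`):
for every order `n`, velocity bound `A` and pressure bound `P` there is `K = K(n, A, P)` such
that a classical solution (`ν = 1`, `f = 0`) on `Q(z, c)` with `|u| ≤ A/c` there and
`∫∫_{Q(z,c)} |p − h(t)|^{3/2} ≤ c² P` for a locally integrable `h` has
`‖Dⁿₓu‖ ≤ K/cⁿ⁺¹` on `Q(z, c/2)` (parabolic zoom, pressure shift, the tree's quantitative
bootstrap `NSBootstrap.exists_smooth_holder_rep_norm`, whose representative agrees with the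
continuous `u`; the physical slices are smooth, so the dilation acts on `Dⁿ` by `c⁻ⁿ⁻¹`).
[cite: PineauVicol2026, Lemma 9.1, arXiv:2607.09619 p. 30] -/
theorem exists_forall_iteratedFDeriv_le_of_bounded (n : ℕ) (A : ℝ) (P : ℝ≥0) :
    ∃ K : ℝ, 0 ≤ K ∧ ∀ (u : ℝ → EuclideanSpace ℝ (Fin 3) → EuclideanSpace ℝ (Fin 3))
      (p : ℝ → EuclideanSpace ℝ (Fin 3) → ℝ) (h : ℝ → ℝ) (z : ℝ × EuclideanSpace ℝ (Fin 3)) (c : ℝ),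
      0 < c →
      IsClassicalNSSolutionOnRegion (parabolicCylinder c z) 1 0 u p →
      (∀ w ∈ parabolicCylinder c z, ‖u w.1 w.2‖ ≤ A / c) →
      LocallyIntegrableOn (fun w : ℝ × EuclideanSpace ℝ (Fin 3) => h w.1) (parabolicCylinder c z)
        volume →
      (∫⁻ w in parabolicCylinder c z, ‖p w.1 w.2 - h w.1‖ₑ ^ (3 / 2 : ℝ) ≤
        ENNReal.ofReal (c ^ 2) * P) →
      ∀ w ∈ parabolicCylinder (c / 2) z,
        ‖iteratedFDeriv ℝ n (u w.1) w.2‖ ≤ K / c ^ (n + 1) := by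
  obtain ⟨Kf, Cf, αf, hαf, hnorm⟩ := NSBootstrap.exists_smooth_holder_rep_norm 1 A P
  refine ⟨Kf n (1 / 2), (Kf n (1 / 2)).coe_nonneg, ?_⟩
  intro u p h z c hc hreg hbd hh hP w hw
  have hc2 : 0 < c ^ 2 := by positivity
  set Q : Set (ℝ × EuclideanSpace ℝ (Fin 3)) := parabolicCylinder c z with hQ_def
  have hQo : IsOpen Q := isOpen_parabolicCylinder c z
  set Φ := stAffine (c ^ 2) c z.1 z.2 with hΦ_def
  have hpre : Φ ⁻¹' Q = parabolicCylinder 1 (0 : ℝ × EuclideanSpace ℝ (Fin 3)) :=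
    stAffine_sq_preimage_parabolicCylinder_self hc z
  -- the zoomed classical solution on `Q(0, 1)`
  set v : ℝ → EuclideanSpace ℝ (Fin 3) → EuclideanSpace ℝ (Fin 3) :=
    c • stPull (c ^ 2) c z.1 z.2 u with hv_def
  set ph : ℝ → EuclideanSpace ℝ (Fin 3) → ℝ := fun t x => p t x - h t with hph_def
  set q : ℝ → EuclideanSpace ℝ (Fin 3) → ℝ := c ^ 2 • stPull (c ^ 2) c z.1 z.2 p with hq_def
  set hz : ℝ → ℝ := fun s => c ^ 2 * h (z.1 + c ^ 2 * s) with hhz_def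
  have hcl : IsClassicalNSSolutionOnRegion (parabolicCylinder 1 (0 : ℝ × EuclideanSpace ℝ (Fin 3)))
      1 0 v q := by
    have h1 := hreg.nsRescale_translate_of_isOpen hQo hc z.1 z.2
    have ef : (c ^ 2 * c) • stPull (c ^ 2) c z.1 z.2
        (0 : ℝ → EuclideanSpace ℝ (Fin 3) → EuclideanSpace ℝ (Fin 3)) = 0 := by
      funext s y; simp [stPull_apply]
    rw [ef, hpre] at h1
    exact h1
  have hdist : IsDistributionalNSSolutionOn
      (parabolicCylinderOpens 1 (0 : ℝ × EuclideanSpace ℝ (Fin 3))) 1 0 v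
      (fun s y => q s y - hz s) := by
    have hd := hcl.isDistributionalNSSolutionOn (isOpen_parabolicCylinder 1 0)
      (Q := parabolicCylinderOpens 1 (0 : ℝ × EuclideanSpace ℝ (Fin 3))) Subset.rfl
    refine hd.sub_timeFun ?_
    have hF := (hh.comp_stAffine hc2 hc z.1 z.2).smul (c ^ 2)
    have e : (c ^ 2) • ((fun w : ℝ × EuclideanSpace ℝ (Fin 3) => h w.1) ∘
        stAffine (c ^ 2) c z.1 z.2) = fun w : ℝ × EuclideanSpace ℝ (Fin 3) => hz w.1 := by
      funext w
      simp [hhz_def, stAffine, smul_eq_mul]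
    rw [e, ← hΦ_def, hpre] at hF
    exact hF
  have hbd' : ∀ᵐ w ∂(volume.restrict (parabolicCylinder 1 (0 : ℝ × EuclideanSpace ℝ (Fin 3)))),
      ‖v w.1 w.2‖ ≤ A := by
    filter_upwards [ae_restrict_mem (isOpen_parabolicCylinder 1 0).measurableSet] with w hw'
    have hΦw : Φ w ∈ Q := by rw [← mem_preimage, hpre]; exact hw'
    have hb := hbd (Φ w) hΦw
    have e : v w.1 w.2 = c • u (Φ w).1 (Φ w).2 := rfl
    rw [e, norm_smul, Real.norm_of_nonneg hc.le]
    calc c * ‖u (Φ w).1 (Φ w).2‖ ≤ c * (A / c) := by gcongr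
      _ = A := by field_simp
  have hP' : ∫⁻ w in parabolicCylinder 1 (0 : ℝ × EuclideanSpace ℝ (Fin 3)),
      ‖q w.1 w.2 - hz w.1‖ₑ ^ (3 / 2 : ℝ) ≤ P := by
    have e : (fun w : ℝ × EuclideanSpace ℝ (Fin 3) => ‖q w.1 w.2 - hz w.1‖ₑ ^ (3 / 2 : ℝ)) =
        fun w => ‖(c ^ 2 • stPull (c ^ 2) c z.1 z.2 ph) w.1 w.2‖ₑ ^ (3 / 2 : ℝ) := by
      funext w
      congr 2
      simp only [hq_def, hph_def, hhz_def, Pi.smul_apply, stPull_apply, smul_eq_mul]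
      ring
    rw [e, ← hpre, hΦ_def, setLIntegral_enorm_rpow_stRescale hc2 hc z.1 z.2 (c ^ 2) ph Q
      (r := 3 / 2) (by norm_num), finrank_euclideanSpace_fin]
    have e0 : (c ^ 2 : ℝ) ^ (3 / 2 : ℝ) = c ^ 3 := by
      rw [show (c ^ 2 : ℝ) = c ^ (2 : ℝ) by norm_cast, ← Real.rpow_mul hc.le,
        show (2 : ℝ) * (3 / 2) = ((3 : ℕ) : ℝ) by norm_num, Real.rpow_natCast]
    have e1 : ‖(c ^ 2 : ℝ)‖ₑ ^ (3 / 2 : ℝ) * ENNReal.ofReal (c ^ 2 * c ^ 3)⁻¹ *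
        ENNReal.ofReal (c ^ 2) = 1 := by
      have er : c ^ 3 * (c ^ 2 * c ^ 3)⁻¹ * c ^ 2 = 1 := by field_simp
      rw [Real.enorm_eq_ofReal hc2.le, ENNReal.ofReal_rpow_of_nonneg hc2.le (by norm_num), e0,
        ← ENNReal.ofReal_mul (pow_nonneg hc.le 3), ← ENNReal.ofReal_mul (by positivity), er,
        ENNReal.ofReal_one]
    calc ‖(c ^ 2 : ℝ)‖ₑ ^ (3 / 2 : ℝ) * ENNReal.ofReal (c ^ 2 * c ^ 3)⁻¹ *
          ∫⁻ w in Q, ‖ph w.1 w.2‖ₑ ^ (3 / 2 : ℝ)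
        ≤ ‖(c ^ 2 : ℝ)‖ₑ ^ (3 / 2 : ℝ) * ENNReal.ofReal (c ^ 2 * c ^ 3)⁻¹ *
            (ENNReal.ofReal (c ^ 2) * P) := by gcongr
      _ = P := by rw [← mul_assoc, e1, one_mul]
  -- the quantitative Serrin theorem
  obtain ⟨V, hVae, hVs, hVn⟩ := hnorm v _ hdist hbd' hP'
  obtain ⟨hH0, -⟩ := hVn 0 (3 / 4) ⟨by norm_num, by norm_num⟩
  obtain ⟨-, hKn⟩ := hVn n (1 / 2) ⟨by norm_num, by norm_num⟩
  -- `V = v` on `Q(0, 3/4)`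
  have hVc : ContinuousOn (uncurry V) (parabolicCylinder (3 / 4) (0 : ℝ × EuclideanSpace ℝ (Fin 3))) := by
    have h1 := hH0.continuousOn (hαf 0 (3 / 4) ⟨by norm_num, by norm_num⟩)
    have h2 : ContinuousOn (fun w : ℝ × EuclideanSpace ℝ (Fin 3) =>
        (iteratedFDeriv ℝ 0 (V w.1) w.2) (fun _ => 0))
        (parabolicCylinder (3 / 4) (0 : ℝ × EuclideanSpace ℝ (Fin 3))) :=
      (continuous_eval_const (fun _ : Fin 0 => (0 : EuclideanSpace ℝ (Fin 3)))).comp_continuousOn h1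
    refine h2.congr fun w _ => ?_
    simp only [iteratedFDeriv_zero_apply]
    rfl
  have hvc : ContinuousOn (uncurry v) (parabolicCylinder 1 (0 : ℝ × EuclideanSpace ℝ (Fin 3))) := by
    have e : uncurry v = c • (uncurry u ∘ Φ) := by funext w; rfl
    rw [e]
    refine ContinuousOn.const_smul (hreg.smooth_velocity.continuousOn.comp
      (continuous_stAffine _ _ _ _).continuousOn fun w hw' => ?_) c
    have hw'' : w ∈ Φ ⁻¹' Q := by rw [hpre]; exact hw'
    exact hw''
  have hsub34 : parabolicCylinder (3 / 4) (0 : ℝ × EuclideanSpace ℝ (Fin 3)) ⊆ parabolicCylinder 1 0 :=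
    prod_mono (Ioo_subset_Ioo (by norm_num) le_rfl) (ball_subset_ball (by norm_num))
  have hsub12 : parabolicCylinder (1 / 2) (0 : ℝ × EuclideanSpace ℝ (Fin 3)) ⊆ parabolicCylinder (3 / 4) 0 :=
    prod_mono (Ioo_subset_Ioo (by norm_num) le_rfl) (ball_subset_ball (by norm_num))
  have hEq : EqOn (uncurry v) (uncurry V) (parabolicCylinder (3 / 4) (0 : ℝ × EuclideanSpace ℝ (Fin 3))) :=
    NSBootstrap.eqOn_of_ae_eq_of_continuousOn (isOpen_parabolicCylinder _ _) (hvc.mono hsub34) hVc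
      (ae_restrict_of_ae_restrict_of_subset hsub34 hVae)
  -- iterated derivatives of `v` on `Q(0, 1/2)`
  have hitv : ∀ w' ∈ parabolicCylinder (1 / 2) (0 : ℝ × EuclideanSpace ℝ (Fin 3)),
      ‖iteratedFDeriv ℝ n (v w'.1) w'.2‖ ≤ Kf n (1 / 2) := by
    intro w' hw'
    have hev : v w'.1 =ᶠ[𝓝 w'.2] V w'.1 := by
      have hw34 : w' ∈ parabolicCylinder (3 / 4) (0 : ℝ × EuclideanSpace ℝ (Fin 3)) := hsub12 hw'
      rw [mem_parabolicCylinder] at hw34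
      have hopen : IsOpen {y : EuclideanSpace ℝ (Fin 3) | dist y (0 : ℝ × EuclideanSpace ℝ (Fin 3)).2 < 3 / 4} :=
        isOpen_lt (continuous_id.dist continuous_const) continuous_const
      filter_upwards [hopen.mem_nhds hw34.2] with y hy
      have hmem : ((w'.1, y) : ℝ × EuclideanSpace ℝ (Fin 3)) ∈
          parabolicCylinder (3 / 4) (0 : ℝ × EuclideanSpace ℝ (Fin 3)) :=
        mem_parabolicCylinder.2 ⟨hw34.1, hy⟩
      exact hEq hmem
    rw [(hev.iteratedFDeriv ℝ n).eq_of_nhds]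
    exact hKn w' hw'
  -- unscale: `u(w.1, x) = c⁻¹ • v(w'.1, c⁻¹ • (x − z.2))`
  set w' : ℝ × EuclideanSpace ℝ (Fin 3) := ((w.1 - z.1) / c ^ 2, c⁻¹ • (w.2 - z.2)) with hw'_def
  have hw'mem : w' ∈ parabolicCylinder (1 / 2) (0 : ℝ × EuclideanSpace ℝ (Fin 3)) := by
    have : w ∈ parabolicCylinder (c * (1 / 2)) z := by rwa [mul_one_div]
    exact inv_zoom_mem_parabolicCylinder hc this
  have hident : u w.1 = fun x => c⁻¹ • v w'.1 (c⁻¹ • (x - z.2)) := by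
    funext x
    simp only [hv_def, Pi.smul_apply, stPull_apply, hw'_def]
    rw [smul_smul, inv_mul_cancel₀ hc.ne', one_smul, smul_smul, mul_inv_cancel₀ hc.ne', one_smul,
      add_sub_cancel]
    congr 1
    field_simp
    ring
  -- a globally smooth representative of the slice `v w'.1` near `w'.2`
  have hslice_smooth : ContDiffOn ℝ (⊤ : ℕ∞) (v w'.1) (ball (0 : EuclideanSpace ℝ (Fin 3)) 1) := by
    have hw1 : w'.1 ∈ Ioo ((0 : ℝ × EuclideanSpace ℝ (Fin 3)).1 - 1 ^ 2) (0 : ℝ × EuclideanSpace ℝ (Fin 3)).1 := by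
      have := (mem_parabolicCylinder.1 (hsub34 (hsub12 hw'mem))).1
      simpa using this
    have hsec := hcl.contDiffOn_velocity w'.1
    rw [show parabolicCylinder 1 (0 : ℝ × EuclideanSpace ℝ (Fin 3)) =
      Ioo ((0 : ℝ × EuclideanSpace ℝ (Fin 3)).1 - 1 ^ 2) (0 : ℝ × EuclideanSpace ℝ (Fin 3)).1 ×ˢ
        ball (0 : ℝ × EuclideanSpace ℝ (Fin 3)).2 1 by rfl, spaceSection_prod hw1] at hsec
    simpa using hsec
  have hy₀ : w'.2 ∈ ball (0 : EuclideanSpace ℝ (Fin 3)) 1 := by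
    have := (mem_parabolicCylinder.1 (hsub34 (hsub12 hw'mem))).2
    simpa using this
  obtain ⟨H, hH, hHv⟩ :=
    ContDiffOn.exists_contDiff_eventuallyEq_of_finiteDimensional hslice_smooth isOpen_ball hy₀
  -- `u w.1` agrees near `w.2` with `x ↦ c⁻¹ • H (c⁻¹ • (x − z.2))`
  have hA : Tendsto (fun x : EuclideanSpace ℝ (Fin 3) => c⁻¹ • (x - z.2)) (𝓝 w.2) (𝓝 w'.2) := by
    have hcont : Continuous fun x : EuclideanSpace ℝ (Fin 3) => c⁻¹ • (x - z.2) := by fun_prop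
    have := hcont.tendsto w.2
    simpa only [hw'_def] using this
  have hev2 : u w.1 =ᶠ[𝓝 w.2] fun x => c⁻¹ • H (c⁻¹ • (x - z.2)) := by
    rw [hident]
    have h1 : (fun x : EuclideanSpace ℝ (Fin 3) => v w'.1 (c⁻¹ • (x - z.2))) =ᶠ[𝓝 w.2]
        fun x => H (c⁻¹ • (x - z.2)) := hHv.symm.comp_tendsto hA
    filter_upwards [h1] with x hx
    simp only [hx]
  rw [(hev2.iteratedFDeriv ℝ n).eq_of_nhds]
  have hHn : ‖iteratedFDeriv ℝ n H w'.2‖ ≤ Kf n (1 / 2) := by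
    rw [(hHv.iteratedFDeriv ℝ n).eq_of_nhds]
    exact hitv w' hw'mem
  calc ‖iteratedFDeriv ℝ n (fun x => c⁻¹ • H (c⁻¹ • (x - z.2))) w.2‖
      ≤ |c⁻¹| * |c⁻¹| ^ n * ‖iteratedFDeriv ℝ n H (c⁻¹ • (w.2 - z.2))‖ :=
        norm_iteratedFDeriv_smul_comp_smul_sub_le hH _ _ _ _ _
    _ ≤ |c⁻¹| * |c⁻¹| ^ n * Kf n (1 / 2) := by
        refine mul_le_mul_of_nonneg_left ?_ (by positivity)
        have : c⁻¹ • (w.2 - z.2) = w'.2 := by simp [hw'_def]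
        rw [this]
        exact hHn
    _ = Kf n (1 / 2) / c ^ (n + 1) := by
        rw [abs_of_pos (inv_pos.2 hc), inv_pow, pow_succ]
        field_simp

end SerrinHigher

section AssemblyHigher

-- nested operator types
set_option maxSynthPendingDepth 3

/-- **Pineau–Vicol 2026, Lemma 9.2 for the order `n`, near the vertex and at small scales, with a
constant depending only on `(n, C_u)`** (the `n`-th order version of
`exists_forall_fderiv_le_of_typeI`, same proof with `exists_forall_iteratedFDeriv_le_of_bounded`;
the bound at the point `(x, t)` itself is read off from the open half-cylinder below
`(x, t')`, `t' = (511/512)t`, which contains it). [cite: PineauVicol2026, Lemma 9.2 and its proof, arXiv:2607.09619 p. 30] -/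
theorem exists_forall_iteratedFDeriv_le_of_typeI (n : ℕ) {C₂ : ℝ}
    (hRRS : ∀ (z : ℝ × (EuclideanSpace ℝ (Fin 3))) (ρ : ℝ) (u : ℝ → (EuclideanSpace ℝ (Fin 3)) → (EuclideanSpace ℝ (Fin 3))) (p : ℝ → (EuclideanSpace ℝ (Fin 3)) → ℝ), 0 < ρ →
      AEStronglyMeasurable (uncurry u) (volume.restrict (parabolicCylinder ρ z)) →
      AEStronglyMeasurable (uncurry p) (volume.restrict (parabolicCylinder ρ z)) →
      ∫⁻ w in parabolicCylinder ρ z, ‖u w.1 w.2‖ₑ ^ (3 : ℕ) < ∞ →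
      ∫⁻ w in parabolicCylinder ρ z, ‖p w.1 w.2‖ₑ ^ (3 / 2 : ℝ) < ∞ →
      (∀ φ : ℝ → (EuclideanSpace ℝ (Fin 3)) → ℝ, IsSpaceTimeTestOn (parabolicCylinderOpens ρ z) φ →
        ∫ w in parabolicCylinder ρ z,
          (⟪u w.1 w.2, convect (u w.1) (gradient (φ w.1)) w.2⟫ + p w.1 w.2 * Δ (φ w.1) w.2) = 0) →
      ∀ r : ℝ, 0 < r → r ≤ ρ / 2 →
        ∀ᵐ t ∂(volume.restrict (Ioo (z.1 - ρ ^ 2) z.1)),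
          ∫⁻ x in ball z.2 r, ‖p t x - ⨍ y in ball z.2 r, p t y‖ₑ ^ (3 / 2 : ℝ) ≤
            ENNReal.ofReal C₂ * (∫⁻ x in ball z.2 (2 * r), ‖u t x‖ₑ ^ (3 : ℕ)) +
            ENNReal.ofReal C₂ * ENNReal.ofReal (r ^ (9 / 2 : ℝ)) *
              (∫⁻ y in {y : (EuclideanSpace ℝ (Fin 3)) | 2 * r < dist y z.2 ∧ dist y z.2 < ρ},
                ‖u t y‖ₑ ^ 2 / ENNReal.ofReal (dist y z.2 ^ 4)) ^ (3 / 2 : ℝ) +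
            ENNReal.ofReal C₂ * ENNReal.ofReal (r ^ (9 / 2 : ℝ) / ρ ^ (9 / 2 : ℝ)) *
              ∫⁻ x in ball z.2 ρ, (‖u t x‖ₑ ^ (3 : ℕ) + ‖p t x‖ₑ ^ (3 / 2 : ℝ)))
    {G : ℝ≥0∞} (hGtop : G < ⊤)
    (hG : ∀ (x : (EuclideanSpace ℝ (Fin 3))) (c : ℝ), 0 < c →
      ∫⁻ y in {y : (EuclideanSpace ℝ (Fin 3)) | 2 * c < ‖y - x‖},
        ENNReal.ofReal (‖y‖ ^ (-(2 : ℝ))) * ENNReal.ofReal (‖y - x‖ ^ (-(4 : ℝ))) ≤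
          G * ENNReal.ofReal (c ^ 3)⁻¹)
    (Cu : ℝ) :
    ∃ K : ℝ, 0 ≤ K ∧ ∀ (Bu Bp : ℝ≥0∞), Bu < ⊤ → Bp < ⊤ → ∃ c₁ : ℝ, 0 < c₁ ∧
      ∀ (u : ℝ → (EuclideanSpace ℝ (Fin 3)) → (EuclideanSpace ℝ (Fin 3))) (p : ℝ → (EuclideanSpace ℝ (Fin 3)) → ℝ),
        IsClassicalNSSolutionOnRegion (Ico (-1 : ℝ) 0 ×ˢ ball (0 : (EuclideanSpace ℝ (Fin 3))) 1) 1 0 u p →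
        (∀ t ∈ Ico (-1 : ℝ) 0, ∀ x ∈ ball (0 : (EuclideanSpace ℝ (Fin 3))) 1, ‖u t x‖ ≤ Cu / (Real.sqrt (-t) + ‖x‖)) →
        (∫⁻ w in Ioo (-1 : ℝ) 0 ×ˢ ball (0 : (EuclideanSpace ℝ (Fin 3))) 1, ‖u w.1 w.2‖ₑ ^ (3 : ℕ) ≤ Bu) →
        (∫⁻ w in Ioo (-1 : ℝ) 0 ×ˢ ball (0 : (EuclideanSpace ℝ (Fin 3))) (1 / 32), ‖p w.1 w.2‖ₑ ^ (3 / 2 : ℝ) ≤ Bp) →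
        ∀ t ∈ Ioo (-1 : ℝ) 0, ∀ x : (EuclideanSpace ℝ (Fin 3)), ‖x‖ + Real.sqrt (-t) ≤ c₁ →
          ‖iteratedFDeriv ℝ n (u t) x‖ ≤ K / (‖x‖ + Real.sqrt (-t)) ^ (n + 1) := by
  -- the pressure bound `P₀ = P₀(C_u)` fed into the Serrin estimate
  set V₁ : ℝ≥0∞ := volume (ball (0 : (EuclideanSpace ℝ (Fin 3))) 1) with hV₁
  have hV₁top : V₁ ≠ ⊤ := measure_ball_lt_top.ne
  set P₁ : ℝ≥0∞ := ENNReal.ofReal C₂ * ENNReal.ofReal (Cu ^ 3) * (8 * V₁ + G ^ (3 / 2 : ℝ))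
    with hP₁
  have hP₁top : P₁ ≠ ⊤ := by
    refine ENNReal.mul_ne_top (ENNReal.mul_ne_top ENNReal.ofReal_ne_top ENNReal.ofReal_ne_top)
      (ENNReal.add_ne_top.2 ⟨ENNReal.mul_ne_top (by norm_num) hV₁top,
        ENNReal.rpow_ne_top_of_nonneg (by norm_num) hGtop.ne⟩)
  set P₀ : ℝ≥0 := (P₁ + 1).toNNReal with hP₀
  have hP₀eq : (P₀ : ℝ≥0∞) = P₁ + 1 := by
    rw [hP₀, ENNReal.coe_toNNReal (ENNReal.add_ne_top.2 ⟨hP₁top, ENNReal.one_ne_top⟩)]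
  obtain ⟨K₀, hK₀0, hSer⟩ := exists_forall_iteratedFDeriv_le_of_bounded n Cu P₀
  refine ⟨16 ^ (n + 1) * K₀, by positivity, fun Bu Bp hBut hBpt => ?_⟩
  -- the smallness scale
  set W : ℝ := (ENNReal.ofReal C₂ * ENNReal.ofReal ((64 : ℝ) ^ (9 / 2 : ℝ)) * (Bu + Bp)).toReal
    with hW
  have hW0 : 0 ≤ W := ENNReal.toReal_nonneg
  set ρ₁ : ℝ := (W + 1) ^ (-(2 / 5 : ℝ)) with hρ₁
  have hρ₁0 : 0 < ρ₁ := Real.rpow_pos_of_pos (by linarith) _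
  refine ⟨min (1 / 64) (8 * ρ₁), lt_min (by norm_num) (by positivity), ?_⟩
  intro u p hreg hI hBu hBp
  ----------------------------------------------------------------
  -- Step A: the bound on the open half-cylinder below every admissible point
  ----------------------------------------------------------------
  have key : ∀ t ∈ Ioo (-1 : ℝ) 0, ∀ x : EuclideanSpace ℝ (Fin 3),
      ‖x‖ + Real.sqrt (-t) ≤ min (1 / 64) (8 * ρ₁) →
      ∀ w ∈ parabolicCylinder (min ((1 / 2 : ℝ) / 4) (1 / 6) * (‖x‖ + Real.sqrt (-t)) / 2) (t, x),
        ‖iteratedFDeriv ℝ n (u w.1) w.2‖ ≤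
          K₀ / (min ((1 / 2 : ℝ) / 4) (1 / 6) * (‖x‖ + Real.sqrt (-t))) ^ (n + 1) := by
    intro t ht x hxt
    have hsmall : ‖x‖ + Real.sqrt (-t) ≤ 1 / 64 := hxt.trans (min_le_left _ _)
    have hsmall' : ‖x‖ + Real.sqrt (-t) ≤ 8 * ρ₁ := hxt.trans (min_le_right _ _)
    -- geometry (as in `lintegral_pressure_osc_le`)
    set m : ℝ := min ((1 / 2 : ℝ) / 4) (1 / 6) with hm_def
    have hm : m = 1 / 8 := by rw [hm_def]; norm_num
    set ρ : ℝ := m * (‖x‖ + Real.sqrt (-t)) with hρ_def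
    have ht0 : t < 0 := ht.2
    have hsq : 0 < Real.sqrt (-t) := Real.sqrt_pos.2 (by linarith)
    have hρ0 : 0 < ρ := pineauVicol_lemma92_radius_pos (x := x) (ε := 1 / 2) (by norm_num) ht0
    have hρle : ρ ≤ 1 / 512 := by rw [hρ_def, hm]; linarith
    have hρρ₁ : ρ ≤ ρ₁ := by rw [hρ_def, hm]; linarith
    have hx : ‖x‖ < 1 - 1 / 2 := by linarith [hsq.le, norm_nonneg x]
    have ht1 : -(1 - 1 / 2 : ℝ) ^ 2 < t := by
      have h1 : Real.sqrt (-t) ≤ 1 / 64 := by linarith [norm_nonneg x]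
      have h2 : -t ≤ (1 / 64) ^ 2 := by
        have := Real.sq_sqrt (by linarith : (0 : ℝ) ≤ -t)
        nlinarith [Real.sqrt_nonneg (-t)]
      nlinarith
    have hCu : 0 ≤ Cu := by
      have h := hI (-(1 / 2 : ℝ)) ⟨by norm_num, by norm_num⟩ 0 (mem_ball_self one_pos)
      rw [norm_zero, add_zero] at h
      have hs : 0 < Real.sqrt (-(-(1 / 2 : ℝ))) := Real.sqrt_pos.2 (by norm_num)
      have h0 : 0 ≤ Cu / Real.sqrt (-(-(1 / 2 : ℝ))) := (norm_nonneg _).trans h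
      exact (div_nonneg_iff.1 h0).elim (fun h => h.1) fun h => absurd h.2 (not_le.2 hs)
    set z : ℝ × (EuclideanSpace ℝ (Fin 3)) := (t, x) with hz_def
    -- comparison of radii (`ρ` versus the `2ρ` of Lemma 9.2's geometry lemmas)
    have hA : ∀ d : ℝ, d ≤ ρ → d < 2 * (min ((1 / 2 : ℝ) / 4) (1 / 6) * (‖x‖ + Real.sqrt (-t))) :=
      fun d hd => by
        show d < 2 * ρ
        linarith
    have hB : ∀ s : ℝ, t - ρ ^ 2 ≤ s →
        t - (2 * (min ((1 / 2 : ℝ) / 4) (1 / 6) * (‖x‖ + Real.sqrt (-t)))) ^ 2 < s :=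
      fun s hs => by
        show t - (2 * ρ) ^ 2 < s
        nlinarith
    -- the small cylinder lies in the open region
    have hO : IsOpen (Ioo (-1 : ℝ) 0 ×ˢ ball (0 : (EuclideanSpace ℝ (Fin 3))) 1) := isOpen_Ioo.prod isOpen_ball
    have hreg' := hreg.mono_of_isOpen (prod_mono Ioo_subset_Ico_self Subset.rfl) hO
    have hQsub : parabolicCylinder ρ z ⊆ Ioo (-1 : ℝ) 0 ×ˢ ball (0 : (EuclideanSpace ℝ (Fin 3))) 1 := by
      intro w hw
      rw [mem_parabolicCylinder] at hw
      obtain ⟨⟨h1, h2⟩, h3⟩ := hw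
      simp only [hz_def] at h1 h2 h3
      obtain ⟨h4, h5, h6⟩ := pineauVicol_lemma92_cylinder_subset (ε := 1 / 2) (by norm_num) (by norm_num)
        hx ht1 ht0 (x' := w.2) (t' := w.1) (hA _ h3.le) (hB _ h1.le) h2.le
      exact mk_mem_prod ⟨h4, h5⟩ h6
    have hregQ : IsClassicalNSSolutionOnRegion (parabolicCylinder ρ z) 1 0 u p :=
      hreg'.mono_of_isOpen hQsub (isOpen_parabolicCylinder ρ z)
    -- the velocity bound `|u| ≤ C_u/ρ` on `Q(z, ρ)`
    have hbd : ∀ w ∈ parabolicCylinder ρ z, ‖u w.1 w.2‖ ≤ Cu / ρ := by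
      intro w hw
      rw [mem_parabolicCylinder] at hw
      obtain ⟨⟨h1, h2⟩, h3⟩ := hw
      simp only [hz_def] at h1 h2 h3
      exact pineauVicol_lemma92_velocity_bound (ε := 1 / 2) hCu hI (by norm_num) (by norm_num)
        hx ht1 ht0 (hA _ h3.le) (hB _ h1.le) h2.le
    -- the mean-free pressure bound
    have hosc := lintegral_pressure_osc_le hRRS hG hreg hI hBut hBpt hBu hBp ht hsmall
    have htail : ENNReal.ofReal C₂ * ENNReal.ofReal ((64 * ρ) ^ (9 / 2 : ℝ)) * (Bu + Bp) ≤
        ENNReal.ofReal (ρ ^ 2) := by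
      -- `C₂ (64ρ)^{9/2} (Bu + Bp) = ρ^{9/2} W ≤ ρ²` iff `ρ^{5/2} W ≤ 1`
      have hWtop : ENNReal.ofReal C₂ * ENNReal.ofReal ((64 : ℝ) ^ (9 / 2 : ℝ)) * (Bu + Bp) ≠ ⊤ :=
        ENNReal.mul_ne_top (ENNReal.mul_ne_top ENNReal.ofReal_ne_top ENNReal.ofReal_ne_top)
          (ENNReal.add_ne_top.2 ⟨hBut.ne, hBpt.ne⟩)
      have e1 : ENNReal.ofReal C₂ * ENNReal.ofReal ((64 * ρ) ^ (9 / 2 : ℝ)) * (Bu + Bp) =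
          ENNReal.ofReal (ρ ^ (9 / 2 : ℝ)) * ENNReal.ofReal W := by
        rw [hW, ENNReal.ofReal_toReal hWtop, Real.mul_rpow (by norm_num) hρ0.le,
          ENNReal.ofReal_mul (by positivity)]
        ring
      rw [e1, ← ENNReal.ofReal_mul (by positivity)]
      refine ENNReal.ofReal_le_ofReal ?_
      -- `ρ^{9/2} W ≤ ρ²`
      have hρ52 : ρ ^ (9 / 2 : ℝ) = ρ ^ 2 * ρ ^ (5 / 2 : ℝ) := by
        rw [show (9 / 2 : ℝ) = 2 + 5 / 2 by norm_num, Real.rpow_add hρ0,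
          show (2 : ℝ) = ((2 : ℕ) : ℝ) by norm_num, Real.rpow_natCast]
      have hρW : ρ ^ (5 / 2 : ℝ) * W ≤ 1 := by
        have h1 : ρ ^ (5 / 2 : ℝ) ≤ ρ₁ ^ (5 / 2 : ℝ) := Real.rpow_le_rpow hρ0.le hρρ₁ (by norm_num)
        have h2 : ρ₁ ^ (5 / 2 : ℝ) = (W + 1)⁻¹ := by
          rw [hρ₁, ← Real.rpow_mul (by linarith)]
          norm_num
          rw [Real.rpow_neg_one]
        calc ρ ^ (5 / 2 : ℝ) * W ≤ (W + 1)⁻¹ * W := by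
              rw [← h2]; exact mul_le_mul_of_nonneg_right h1 hW0
          _ ≤ (W + 1)⁻¹ * (W + 1) := by gcongr; linarith
          _ = 1 := inv_mul_cancel₀ (by linarith)
      calc ρ ^ (9 / 2 : ℝ) * W = ρ ^ 2 * (ρ ^ (5 / 2 : ℝ) * W) := by rw [hρ52]; ring
        _ ≤ ρ ^ 2 * 1 := by gcongr
        _ = ρ ^ 2 := mul_one _
    have hPbound : ∫⁻ w in parabolicCylinder ρ z,
        ‖p w.1 w.2 - ⨍ y in ball x ρ, p w.1 y‖ₑ ^ (3 / 2 : ℝ) ≤ ENNReal.ofReal (ρ ^ 2) * P₀ := by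
      have e : ENNReal.ofReal (ρ ^ 2) * (P₀ : ℝ≥0∞) =
          ENNReal.ofReal (ρ ^ 2) * P₁ + ENNReal.ofReal (ρ ^ 2) := by
        rw [hP₀eq, mul_add, mul_one]
      rw [e]
      exact hosc.trans (add_le_add le_rfl htail)
    -- local integrability of the mean (bounded and a.e. strongly measurable on the cylinder)
    have hQbig : parabolicCylinder ρ z ⊆ Ioo (-1 : ℝ) 0 ×ˢ ball (0 : (EuclideanSpace ℝ (Fin 3))) 1 := hQsub
    have hpc : ContinuousOn (uncurry p) (parabolicCylinder ρ z) :=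
      hreg'.smooth_pressure.continuousOn.mono hQbig
    have hprod : (volume : Measure (ℝ × (EuclideanSpace ℝ (Fin 3)))).restrict (parabolicCylinder ρ z) =
        (volume.restrict (Ioo (t - ρ ^ 2) t)).prod (volume.restrict (ball x ρ)) := by
      rw [RRS2016.volume_restrict_parabolicCylinder ρ z]
    have hpQ : AEStronglyMeasurable (uncurry p)
        ((volume.restrict (Ioo (t - ρ ^ 2) t)).prod (volume.restrict (ball x ρ))) := by
      rw [← hprod]
      exact hpc.aestronglyMeasurable (isOpen_parabolicCylinder ρ z).measurableSet
    have hmean : AEStronglyMeasurable (fun t' => ⨍ y in ball x ρ, p t' y)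
        (volume.restrict (Ioo (t - ρ ^ 2) t)) := by
      have h1 := hpQ.integral_prod_right'
      have e : (fun t' => ⨍ y in ball x ρ, p t' y) =
          fun t' => (volume.real (ball x ρ))⁻¹ • ∫ y, p t' y ∂(volume.restrict (ball x ρ)) := by
        funext t'
        rw [setAverage_eq]
      rw [e]
      exact h1.const_smul ((volume.real (ball x ρ))⁻¹ : ℝ)
    -- the mean is bounded: `p` is continuous on the compact closure `[t-ρ², t] × B̄(x, ρ)`
    have hKc : IsCompact (Icc (t - ρ ^ 2) t ×ˢ closedBall x ρ) :=
      isCompact_Icc.prod (isCompact_closedBall x ρ)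
    have hKsub : Icc (t - ρ ^ 2) t ×ˢ closedBall x ρ ⊆ Ioo (-1 : ℝ) 0 ×ˢ ball (0 : (EuclideanSpace ℝ (Fin 3))) 1 := by
      intro w hw
      obtain ⟨⟨h1, h2⟩, h3⟩ := hw
      rw [mem_closedBall] at h3
      obtain ⟨h4, h5, h6⟩ := pineauVicol_lemma92_cylinder_subset (ε := 1 / 2) (by norm_num) (by norm_num)
        hx ht1 ht0 (x' := w.2) (t' := w.1) (hA _ h3) (hB _ h1) h2
      exact mk_mem_prod ⟨h4, lt_of_le_of_lt h2 ht0⟩ h6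
    obtain ⟨M, hM⟩ := hKc.exists_bound_of_continuousOn
      (hreg'.smooth_pressure.continuousOn.mono hKsub)
    have hmeanbd : ∀ t' ∈ Ioo (t - ρ ^ 2) t, ‖⨍ y in ball x ρ, p t' y‖ ≤ M := by
      intro t' ht'
      rw [setAverage_eq, norm_smul, norm_inv, Real.norm_of_nonneg measureReal_nonneg]
      have hvol : 0 < volume.real (ball x ρ) := by
        rw [measureReal_def]
        exact ENNReal.toReal_pos (measure_ball_pos volume x hρ0).ne' measure_ball_lt_top.ne
      have hint : ‖∫ y in ball x ρ, p t' y‖ ≤ M * volume.real (ball x ρ) := by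
        refine norm_setIntegral_le_of_norm_le_const measure_ball_lt_top fun y hy => ?_
        exact hM (t', y) (mk_mem_prod ⟨ht'.1.le, ht'.2.le⟩ (ball_subset_closedBall hy))
      calc (volume.real (ball x ρ))⁻¹ * ‖∫ y in ball x ρ, p t' y‖
          ≤ (volume.real (ball x ρ))⁻¹ * (M * volume.real (ball x ρ)) := by gcongr
        _ = M := by field_simp
    have hloc : LocallyIntegrableOn (fun w : ℝ × (EuclideanSpace ℝ (Fin 3)) => ⨍ y in ball x ρ, p w.1 y)
        (parabolicCylinder ρ z) volume := by
      refine IntegrableOn.locallyIntegrableOn ?_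
      have hvolQ : volume (parabolicCylinder ρ z) < ⊤ := by
        rw [show parabolicCylinder ρ z = Ioo (t - ρ ^ 2) t ×ˢ ball x ρ by rfl, Measure.volume_eq_prod,
          Measure.prod_prod]
        exact ENNReal.mul_lt_top (by simp) measure_ball_lt_top
      refine IntegrableOn.of_bound hvolQ ?_ M ?_
      · rw [hprod]
        exact hmean.comp_fst
      · rw [ae_restrict_iff' (isOpen_parabolicCylinder ρ z).measurableSet]
        filter_upwards with w hw
        rw [mem_parabolicCylinder] at hw
        have hw1 : t - ρ ^ 2 < w.1 ∧ w.1 < t := by simpa only [hz_def] using hw.1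
        exact hmeanbd w.1 hw1
    -- the Serrin bound on `Q(z, ρ/2)`
    exact hSer u p (fun t' => ⨍ y in ball x ρ, p t' y) z ρ hρ0 hregQ hbd hloc hPbound
  ----------------------------------------------------------------
  -- Step B: the point `(t, x)` lies in the half-cylinder below `(t', x)`, `t' = (511/512) t`
  ----------------------------------------------------------------
  intro t ht x hxt
  have ht0 : t < 0 := ht.2
  have hsq : 0 < Real.sqrt (-t) := Real.sqrt_pos.2 (by linarith)
  set t' : ℝ := (511 / 512) * t with ht'_def
  have ht'0 : t' < 0 := by rw [ht'_def]; linarith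
  have htt' : t < t' := by rw [ht'_def]; linarith
  have ht' : t' ∈ Ioo (-1 : ℝ) 0 := ⟨by linarith [ht.1], ht'0⟩
  have hsq' : Real.sqrt (-t') ≤ Real.sqrt (-t) := Real.sqrt_le_sqrt (by linarith)
  have hsq'' : Real.sqrt (-t) / 2 ≤ Real.sqrt (-t') := by
    rw [div_le_iff₀ (by norm_num : (0 : ℝ) < 2)]
    have h1 : Real.sqrt (-t) = Real.sqrt (-t' * (512 / 511)) := by
      congr 1; rw [ht'_def]; ring
    rw [h1, Real.sqrt_mul (by linarith)]
    have h2 : Real.sqrt (512 / 511 : ℝ) ≤ 2 := by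
      rw [Real.sqrt_le_left (by norm_num)]; norm_num
    have h3 : 0 ≤ Real.sqrt (-t') := Real.sqrt_nonneg _
    nlinarith
  have hxt' : ‖x‖ + Real.sqrt (-t') ≤ min (1 / 64) (8 * ρ₁) := by linarith
  set ρ' : ℝ := min ((1 / 2 : ℝ) / 4) (1 / 6) * (‖x‖ + Real.sqrt (-t')) with hρ'_def
  have hm : min ((1 / 2 : ℝ) / 4) (1 / 6) = 1 / 8 := by norm_num
  have hρ'ge : (‖x‖ + Real.sqrt (-t)) / 16 ≤ ρ' := by
    rw [hρ'_def, hm]; linarith [norm_nonneg x]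
  have hρ'0 : 0 < ρ' := lt_of_lt_of_le (by positivity) hρ'ge
  have hmem : ((t, x) : ℝ × EuclideanSpace ℝ (Fin 3)) ∈ parabolicCylinder (ρ' / 2) (t', x) := by
    rw [mem_parabolicCylinder]
    refine ⟨⟨?_, htt'⟩, by simp [hρ'0]⟩
    -- `t' − (ρ'/2)² < t`: `t' − t = (−t)/512` and `ρ' ≥ √(−t')/8`
    have h1 : Real.sqrt (-t') / 8 ≤ ρ' := by rw [hρ'_def, hm]; linarith [norm_nonneg x]
    have h2 : (-t') / 256 ≤ (ρ' / 2) ^ 2 := by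
      have h3 : (Real.sqrt (-t') / 8) ^ 2 ≤ ρ' ^ 2 :=
        pow_le_pow_left₀ (by positivity) h1 2
      rw [div_pow, Real.sq_sqrt (by linarith)] at h3
      nlinarith
    show t' - (ρ' / 2) ^ 2 < t
    rw [ht'_def] at h2 ⊢
    nlinarith
  have hb := key t' ht' x hxt' (t, x) hmem
  simp only at hb
  calc ‖iteratedFDeriv ℝ n (u t) x‖ ≤ K₀ / ρ' ^ (n + 1) := hb
    _ ≤ K₀ / ((‖x‖ + Real.sqrt (-t)) / 16) ^ (n + 1) := by
        refine div_le_div_of_nonneg_left hK₀0 (by positivity) ?_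
        exact pow_le_pow_left₀ (by positivity) hρ'ge _
    _ = 16 ^ (n + 1) * K₀ / (‖x‖ + Real.sqrt (-t)) ^ (n + 1) := by
        rw [div_pow]
        field_simp

/-- **Lemma 9.2 (all orders) near the vertex, with the constants of the tree instantiated**:
for every order `n` and every `C_u` there is `K = K(n, C_u)` and, for all finite `B_u`, `B_p`, a
scale `c₁ > 0` such that every classical solution on `[−1,0) × B₁` with (1.15),
`∫∫_{(−1,0)×B₁} |u|³ ≤ B_u` and `∫∫_{(−1,0)×B_{1/32}} |p|^{3/2} ≤ B_p` has
`‖Dⁿₓu(x,t)‖ ≤ K (|x| + √(−t))⁻ⁿ⁻¹` for `−1 < t < 0`, `|x| + √(−t) ≤ c₁` (the printed (9.3),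
`|∇ᵏu(x,t)| ≤ C_{k,ε} ((−t)^{(k+1)/2} + |x|^{k+1})⁻¹`, near the vertex and at small scales).
[cite: PineauVicol2026, Lemma 9.2, (9.3), arXiv:2607.09619 p. 30] -/
theorem exists_forall_iteratedFDeriv_le_of_typeI_of_bounds (n : ℕ) (Cu : ℝ) :
    ∃ K : ℝ, 0 ≤ K ∧ ∀ (Bu Bp : ℝ≥0∞), Bu < ⊤ → Bp < ⊤ → ∃ c₁ : ℝ, 0 < c₁ ∧
      ∀ (u : ℝ → (EuclideanSpace ℝ (Fin 3)) → (EuclideanSpace ℝ (Fin 3))) (p : ℝ → (EuclideanSpace ℝ (Fin 3)) → ℝ),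
        IsClassicalNSSolutionOnRegion (Ico (-1 : ℝ) 0 ×ˢ ball (0 : (EuclideanSpace ℝ (Fin 3))) 1) 1 0 u p →
        (∀ t ∈ Ico (-1 : ℝ) 0, ∀ x ∈ ball (0 : (EuclideanSpace ℝ (Fin 3))) 1, ‖u t x‖ ≤ Cu / (Real.sqrt (-t) + ‖x‖)) →
        (∫⁻ w in Ioo (-1 : ℝ) 0 ×ˢ ball (0 : (EuclideanSpace ℝ (Fin 3))) 1, ‖u w.1 w.2‖ₑ ^ (3 : ℕ) ≤ Bu) →
        (∫⁻ w in Ioo (-1 : ℝ) 0 ×ˢ ball (0 : (EuclideanSpace ℝ (Fin 3))) (1 / 32), ‖p w.1 w.2‖ₑ ^ (3 / 2 : ℝ) ≤ Bp) →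
        ∀ t ∈ Ioo (-1 : ℝ) 0, ∀ x : (EuclideanSpace ℝ (Fin 3)), ‖x‖ + Real.sqrt (-t) ≤ c₁ →
          ‖iteratedFDeriv ℝ n (u t) x‖ ≤ K / (‖x‖ + Real.sqrt (-t)) ^ (n + 1) := by
  obtain ⟨C₂, -, hRRS⟩ := RRS2016.lemma15_12_holds
  obtain ⟨G, hGtop, hG⟩ := exists_farField_bound
  exact exists_forall_iteratedFDeriv_le_of_typeI n hRRS hGtop hG Cu

end AssemblyHigher

end Literature.Analysis.FluidPDE

end
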